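import Literature.InformationTheory.QuantumCodes.CSSPhenomenologicalConverse
import Literature.InformationTheory.QuantumCodes.TwoRateThreshold
import HarnessLib

/-!
# BOTH error types at once (Dennis–Kitaev–Landahl–Preskill's own noise model): independent `X` and `Z` qubit faults at rate `p`,
# both check records wrong at rate `q`, sector-wise space-time decoding — `P_fail = P^Z + P^X − P^Z·P^X` EXACTLY

Topic `Literature/InformationTheory/QuantumCodes` (venture QEC, LADDER-QEC rung Q5, PARTITION row 09 "phenomenological"; qec-type-09 gen 5).
The tree's phenomenological threshold theorems (`CSSPhenomenologicalThreshold.lean`, `ToricCodePhenomenological*.lean`) are ONE-SECTOR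
statements: phase flips with the `X`-check record, or bit flips with the `Z`-check record. Dennis–Kitaev–Landahl–Preskill's memory model
(§4.1, arXiv:quant-ph/0110143 chunk p0012 L5–18) has both at once: "the errors acting on different qubits are independent, … bit-flip
($X$) errors and phase ($Z$) errors are uncorrelated with one another, and … $X$ and $Z$ errors are equally likely" (qubit channel
`ρ ↦ (1-p)²ρ + p(1-p)XρX + p(1-p)ZρZ + p²YρY`, L11–16), "We will denote by $q$ the probability that the measured syndrome bit is faulty
at a given site or plaquette" (L18), and recovery runs separately on the two error types ("we have separate procedures for recovery from
the $X$ errors and the $Z$ errors", L16). Since the `Z`-type data `(z, m_X)` (phase-flip history with the `X`-check measurement faults)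
and the `X`-type data `(x, m_Z)` are INDEPENDENT, the joint law is the product of the two one-sector two-rate laws
`phenomenologicalWeight T p q`, and the memory experiment fails iff one of the two sector decoders fails. PROVED, elementary, no named
fact (1 definition):

* `CSSCode.bothSectorsPhenomFailureProb C T DZ DX p q` — the failure probability of the pair `(DZ, DX)` of space-time decoders under the
  product law (definition, a finite sum over pairs of one-sector histories);
* `CSSCode.bothSectorsPhenomFailureProb_eq` — **`P_fail = P^Z + P^X − P^Z·P^X`** with `P^Z = CSSPhenom.phenomFailureProb C.HX T (rs H^Z) DZ p q`,
  `P^X = CSSPhenom.phenomFailureProb C.HZ T (rs H^X) DX p q` (independence; exact);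
* `CSSCode.max_le_bothSectorsPhenomFailureProb`, `CSSCode.bothSectorsPhenomFailureProb_le_add` — `max(P^Z, P^X) ≤ P_fail ≤ P^Z + P^X`
  (rates in `[0, 1]`);
* `CSSCode.bothSectors_belowThreshold_iff` — along a family: `P_fail → 0 ↔ (P^Z → 0 ∧ P^X → 0)`; `CSSCode.bothSectors_isThresholdBoxLowerBound`
  — two certified sector boxes `p₀` give the certified box `p₀` for the whole memory.

## References

* [DennisEtAl2002] E. Dennis, A. Kitaev, A. Landahl, J. Preskill, *Topological quantum memory*, J. Math. Phys. 43 (2002) 4452–4505,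
  arXiv:quant-ph/0110143, §4.1 (chunk p0012 L5–18: the error model — independent qubits, uncorrelated equally likely X/Z errors at rate p,
  measurement faults at rate q, separate recovery), §5.2 (Prob_fail), §5.3 eq. (threshold_iso_num).
-/

noncomputable section

namespace Literature.InformationTheory.QuantumCodes

open Finset Matrix Filter Topology

namespace CSSPhenom

variable {ι V : Type*} [Fintype ι] [DecidableEq ι] [Fintype V] [DecidableEq V] {T : ℕ}

/-- The one-sector two-rate law is a probability law on histories: `Σ_E w_{p,q}(E) = 1`. [cite: DennisEtAl2002, §4.4 eq. (prob_E)] -/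
theorem sum_phenomenologicalWeight_supp (T : ℕ) (p q : ℝ) :
    ∑ E : History ι V T, phenomenologicalWeight T p q (supp E) = 1 :=
  sum_indepWeight_supp (X := HistoryLoc V ι T) (phenomRate p q)

/-- The one-sector two-rate law is non-negative for rates in `[0, 1]`. [cite: DennisEtAl2002, §4.4 eq. (prob_E)] -/
theorem phenomenologicalWeight_supp_nonneg {p q : ℝ} (hp0 : 0 ≤ p) (hp1 : p ≤ 1) (hq0 : 0 ≤ q) (hq1 : q ≤ 1)
    (E : History ι V T) : 0 ≤ phenomenologicalWeight T p q (supp E) := by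
  unfold phenomenologicalWeight
  refine indepWeight_nonneg (fun ℓ => ?_) (fun ℓ => ?_) _
  · cases ℓ <;> simpa [phenomRate]
  · cases ℓ <;> simpa [phenomRate]

open Classical in
/-- Success + failure = 1 for one sector: `Σ_{E : D corrects} w(E) = 1 − P^{ph}`. [cite: DennisEtAl2002, §5.2 (Prob_fail)] -/
theorem sum_corrects_phenomenologicalWeight (H : Matrix ι V (ZMod 2)) (T : ℕ) (SX : Set (V → ZMod 2))
    (D : STDecoder ι V T) (p q : ℝ) :
    (∑ E ∈ univ.filter (fun E : History ι V T => D.Corrects (stSyn H T) (stTrivial SX T) E),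
        phenomenologicalWeight T p q (supp E)) = 1 - phenomFailureProb H T SX D p q := by
  unfold phenomFailureProb
  have h := Finset.sum_filter_add_sum_filter_not (univ : Finset (History ι V T))
    (fun E => D.Corrects (stSyn H T) (stTrivial SX T) E) (fun E => phenomenologicalWeight T p q (supp E))
  rw [sum_phenomenologicalWeight_supp] at h
  linarith

end CSSPhenom

namespace CSSCode

open CSSPhenom

variable {RX RZ Q : Type*} [Fintype Q] [Fintype RX] [Fintype RZ] [DecidableEq Q] [DecidableEq RX] [DecidableEq RZ]

open Classical in
/-- **Failure probability of the memory experiment with BOTH error types** (DKLP §4.1 model): the `Z`-type data `EZ` (phase-flip history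
with the `X`-check measurement faults) and the `X`-type data `EX` (bit-flip history with the `Z`-check measurement faults) are drawn
INDEPENDENTLY from the one-sector two-rate laws `(p, q)`; the space-time decoders `DZ`, `DX` act on their records; the experiment fails iff
one of them fails. Definition. [cite: DennisEtAl2002, §4.1 (chunk p0012 L5–18: independent qubits, uncorrelated X/Z errors at rate p, faulty syndrome bits at rate q, separate recovery)] -/
def bothSectorsPhenomFailureProb (C : CSSCode RX RZ Q) (T : ℕ) (DZ : STDecoder RX Q T) (DX : STDecoder RZ Q T)
    (p q : ℝ) : ℝ :=
  ∑ EZ : History RX Q T, ∑ EX : History RZ Q T,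
    if ¬ (DZ.Corrects (stSyn C.HX T) (stTrivial (C.rowSpZ : Set (Q → ZMod 2)) T) EZ ∧
          DX.Corrects (stSyn C.HZ T) (stTrivial (C.rowSpX : Set (Q → ZMod 2)) T) EX) then
      phenomenologicalWeight T p q (supp EZ) * phenomenologicalWeight T p q (supp EX)
    else 0

open Classical in
/-- **Independence makes it exact: `P_fail = P^Z + P^X − P^Z · P^X`** (`= 1 − (1 − P^Z)(1 − P^X)`), with `P^Z`, `P^X` the tree's one-sector
two-rate failure probabilities. [cite: DennisEtAl2002, §4.1 (chunk p0012 L11–16: X and Z errors uncorrelated; separate recovery procedures)] -/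
theorem bothSectorsPhenomFailureProb_eq (C : CSSCode RX RZ Q) (T : ℕ) (DZ : STDecoder RX Q T) (DX : STDecoder RZ Q T)
    (p q : ℝ) :
    C.bothSectorsPhenomFailureProb T DZ DX p q =
      phenomFailureProb C.HX T (C.rowSpZ : Set (Q → ZMod 2)) DZ p q +
          phenomFailureProb C.HZ T (C.rowSpX : Set (Q → ZMod 2)) DX p q -
        phenomFailureProb C.HX T (C.rowSpZ : Set (Q → ZMod 2)) DZ p q *
          phenomFailureProb C.HZ T (C.rowSpX : Set (Q → ZMod 2)) DX p q := by
  -- `P_fail = 1 − Σ_{both succeed} = 1 − (Σ_{Z ok} w)(Σ_{X ok} w)`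
  set PZ := phenomFailureProb C.HX T (C.rowSpZ : Set (Q → ZMod 2)) DZ p q
  set PX := phenomFailureProb C.HZ T (C.rowSpX : Set (Q → ZMod 2)) DX p q
  have hZ := sum_corrects_phenomenologicalWeight C.HX T (C.rowSpZ : Set (Q → ZMod 2)) DZ p q
  have hX := sum_corrects_phenomenologicalWeight C.HZ T (C.rowSpX : Set (Q → ZMod 2)) DX p q
  -- total mass of the product law
  have htot : ∑ EZ : History RX Q T, ∑ EX : History RZ Q T,
      phenomenologicalWeight T p q (supp EZ) * phenomenologicalWeight T p q (supp EX) = 1 := by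
    simp_rw [← Finset.mul_sum, sum_phenomenologicalWeight_supp, mul_one, sum_phenomenologicalWeight_supp]
  -- mass of the success event
  have hsucc : ∑ EZ : History RX Q T, ∑ EX : History RZ Q T,
      (if DZ.Corrects (stSyn C.HX T) (stTrivial (C.rowSpZ : Set (Q → ZMod 2)) T) EZ ∧
          DX.Corrects (stSyn C.HZ T) (stTrivial (C.rowSpX : Set (Q → ZMod 2)) T) EX then
        phenomenologicalWeight T p q (supp EZ) * phenomenologicalWeight T p q (supp EX) else 0) =
      (1 - PZ) * (1 - PX) := by
    rw [← hZ, ← hX, Finset.sum_mul]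
    rw [Finset.sum_filter]
    refine Finset.sum_congr rfl fun EZ _ => ?_
    by_cases hz : DZ.Corrects (stSyn C.HX T) (stTrivial (C.rowSpZ : Set (Q → ZMod 2)) T) EZ
    · simp only [hz, true_and, if_true, Finset.mul_sum, Finset.sum_filter]
      refine Finset.sum_congr rfl fun EX _ => ?_
      split_ifs <;> ring
    · simp [hz]
  -- failure = total − success
  have hsplit : C.bothSectorsPhenomFailureProb T DZ DX p q =
      (∑ EZ : History RX Q T, ∑ EX : History RZ Q T,
        phenomenologicalWeight T p q (supp EZ) * phenomenologicalWeight T p q (supp EX)) -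
      ∑ EZ : History RX Q T, ∑ EX : History RZ Q T,
        (if DZ.Corrects (stSyn C.HX T) (stTrivial (C.rowSpZ : Set (Q → ZMod 2)) T) EZ ∧
            DX.Corrects (stSyn C.HZ T) (stTrivial (C.rowSpX : Set (Q → ZMod 2)) T) EX then
          phenomenologicalWeight T p q (supp EZ) * phenomenologicalWeight T p q (supp EX) else 0) := by
    unfold bothSectorsPhenomFailureProb
    rw [← Finset.sum_sub_distrib]
    refine Finset.sum_congr rfl fun EZ _ => ?_
    rw [← Finset.sum_sub_distrib]
    refine Finset.sum_congr rfl fun EX _ => ?_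
    by_cases hc : DZ.Corrects (stSyn C.HX T) (stTrivial (C.rowSpZ : Set (Q → ZMod 2)) T) EZ ∧
        DX.Corrects (stSyn C.HZ T) (stTrivial (C.rowSpX : Set (Q → ZMod 2)) T) EX
    · simp [hc]
    · simp [hc]
  rw [hsplit, htot, hsucc]
  ring

/-- **`P^Z ≤ P_fail` and `P^X ≤ P_fail`** (`max(P^Z, P^X) ≤ P_fail`), rates in `[0, 1]`.
[cite: DennisEtAl2002, §4.3 (recovery fails if either residual is homologically nontrivial)] -/
theorem max_le_bothSectorsPhenomFailureProb (C : CSSCode RX RZ Q) (T : ℕ) (DZ : STDecoder RX Q T) (DX : STDecoder RZ Q T)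
    {p q : ℝ} (hp0 : 0 ≤ p) (hp1 : p ≤ 1) (hq0 : 0 ≤ q) (hq1 : q ≤ 1) :
    max (phenomFailureProb C.HX T (C.rowSpZ : Set (Q → ZMod 2)) DZ p q)
        (phenomFailureProb C.HZ T (C.rowSpX : Set (Q → ZMod 2)) DX p q) ≤
      C.bothSectorsPhenomFailureProb T DZ DX p q := by
  rw [bothSectorsPhenomFailureProb_eq]
  set PZ := phenomFailureProb C.HX T (C.rowSpZ : Set (Q → ZMod 2)) DZ p q
  set PX := phenomFailureProb C.HZ T (C.rowSpX : Set (Q → ZMod 2)) DX p q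
  have hZ0 : 0 ≤ PZ := by
    refine Finset.sum_nonneg fun E _ => phenomenologicalWeight_supp_nonneg hp0 hp1 hq0 hq1 E
  have hX0 : 0 ≤ PX := by
    refine Finset.sum_nonneg fun E _ => phenomenologicalWeight_supp_nonneg hp0 hp1 hq0 hq1 E
  have hZ1 : PZ ≤ 1 := by
    have h := sum_corrects_phenomenologicalWeight C.HX T (C.rowSpZ : Set (Q → ZMod 2)) DZ p q
    have : 0 ≤ 1 - PZ := by
      rw [← h]; exact Finset.sum_nonneg fun E _ => phenomenologicalWeight_supp_nonneg hp0 hp1 hq0 hq1 E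
    linarith
  have hX1 : PX ≤ 1 := by
    have h := sum_corrects_phenomenologicalWeight C.HZ T (C.rowSpX : Set (Q → ZMod 2)) DX p q
    have : 0 ≤ 1 - PX := by
      rw [← h]; exact Finset.sum_nonneg fun E _ => phenomenologicalWeight_supp_nonneg hp0 hp1 hq0 hq1 E
    linarith
  refine max_le ?_ ?_ <;> nlinarith

/-- **`P_fail ≤ P^Z + P^X`** (union bound; rates in `[0, 1]`). [cite: DennisEtAl2002, §4.1 (separate recovery procedures for the X errors and the Z errors)] -/
theorem bothSectorsPhenomFailureProb_le_add (C : CSSCode RX RZ Q) (T : ℕ) (DZ : STDecoder RX Q T) (DX : STDecoder RZ Q T)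
    {p q : ℝ} (hp0 : 0 ≤ p) (hp1 : p ≤ 1) (hq0 : 0 ≤ q) (hq1 : q ≤ 1) :
    C.bothSectorsPhenomFailureProb T DZ DX p q ≤
      phenomFailureProb C.HX T (C.rowSpZ : Set (Q → ZMod 2)) DZ p q +
        phenomFailureProb C.HZ T (C.rowSpX : Set (Q → ZMod 2)) DX p q := by
  rw [bothSectorsPhenomFailureProb_eq]
  have hZ0 : 0 ≤ phenomFailureProb C.HX T (C.rowSpZ : Set (Q → ZMod 2)) DZ p q :=
    Finset.sum_nonneg fun E _ => phenomenologicalWeight_supp_nonneg hp0 hp1 hq0 hq1 E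
  have hX0 : 0 ≤ phenomFailureProb C.HZ T (C.rowSpX : Set (Q → ZMod 2)) DX p q :=
    Finset.sum_nonneg fun E _ => phenomenologicalWeight_supp_nonneg hp0 hp1 hq0 hq1 E
  nlinarith

end CSSCode

/-! ### Families: the two-type memory is below threshold iff both sectors are -/

namespace CSSCode

open CSSPhenom

variable {RX RZ Q : ℕ → Type*} [∀ i, Fintype (Q i)] [∀ i, Fintype (RX i)] [∀ i, Fintype (RZ i)]
  [∀ i, DecidableEq (Q i)] [∀ i, DecidableEq (RX i)] [∀ i, DecidableEq (RZ i)]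

/-- **Below threshold iff both sectors are** (rates in `[0, 1]`): along a family, the two-type failure probability tends to `0` iff both
one-sector two-rate failure probabilities do. [cite: DennisEtAl2002, §4.1 and §5.3 eq. (threshold_iso)] -/
theorem bothSectors_belowThreshold_iff (C : ∀ i, CSSCode (RX i) (RZ i) (Q i)) (T : ℕ → ℕ)
    (DZ : ∀ i, STDecoder (RX i) (Q i) (T i)) (DX : ∀ i, STDecoder (RZ i) (Q i) (T i)) {p q : ℝ} (hp0 : 0 ≤ p) (hp1 : p ≤ 1)
    (hq0 : 0 ≤ q) (hq1 : q ≤ 1) :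
    Tendsto (fun i => (C i).bothSectorsPhenomFailureProb (T i) (DZ i) (DX i) p q) atTop (𝓝 0) ↔
      Tendsto (fun i => phenomFailureProb (C i).HX (T i) ((C i).rowSpZ : Set (Q i → ZMod 2)) (DZ i) p q) atTop (𝓝 0) ∧
        Tendsto (fun i => phenomFailureProb (C i).HZ (T i) ((C i).rowSpX : Set (Q i → ZMod 2)) (DX i) p q) atTop (𝓝 0) := by
  have hZnn : ∀ i, 0 ≤ phenomFailureProb (C i).HX (T i) ((C i).rowSpZ : Set (Q i → ZMod 2)) (DZ i) p q := fun i =>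
    Finset.sum_nonneg fun E _ => phenomenologicalWeight_supp_nonneg hp0 hp1 hq0 hq1 E
  have hXnn : ∀ i, 0 ≤ phenomFailureProb (C i).HZ (T i) ((C i).rowSpX : Set (Q i → ZMod 2)) (DX i) p q := fun i =>
    Finset.sum_nonneg fun E _ => phenomenologicalWeight_supp_nonneg hp0 hp1 hq0 hq1 E
  constructor
  · intro h
    have hm := fun i => (C i).max_le_bothSectorsPhenomFailureProb (T i) (DZ i) (DX i) hp0 hp1 hq0 hq1
    exact ⟨squeeze_zero hZnn (fun i => (le_max_left _ _).trans (hm i)) h,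
      squeeze_zero hXnn (fun i => (le_max_right _ _).trans (hm i)) h⟩
  · rintro ⟨hZ, hX⟩
    have hsum := hZ.add hX
    rw [add_zero] at hsum
    refine squeeze_zero (fun i => ?_) (fun i => (C i).bothSectorsPhenomFailureProb_le_add (T i) (DZ i) (DX i) hp0 hp1 hq0 hq1)
      hsum
    exact (hZnn i).trans ((le_max_left _ _).trans
      ((C i).max_le_bothSectorsPhenomFailureProb (T i) (DZ i) (DX i) hp0 hp1 hq0 hq1))

/-- **Two certified sector boxes give the certified box for the whole memory**: if every `0 ≤ p, q < p₀` is below threshold for the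
`Z`-sector and for the `X`-sector two-rate families (`p₀ ≤ 1`), it is below threshold for the two-type memory experiment.
[cite: DennisEtAl2002, §5.3 eq. (threshold_iso_num) ("the accuracy threshold is surely attained provided that … p, q < .0114")] -/
theorem bothSectors_isThresholdBoxLowerBound (C : ∀ i, CSSCode (RX i) (RZ i) (Q i)) (T : ℕ → ℕ)
    (DZ : ∀ i, STDecoder (RX i) (Q i) (T i)) (DX : ∀ i, STDecoder (RZ i) (Q i) (T i)) {p₀ : ℝ} (hp₀ : p₀ ≤ 1)
    (hZ : IsThresholdBoxLowerBound
      (fun i p q => phenomFailureProb (C i).HX (T i) ((C i).rowSpZ : Set (Q i → ZMod 2)) (DZ i) p q) p₀)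
    (hX : IsThresholdBoxLowerBound
      (fun i p q => phenomFailureProb (C i).HZ (T i) ((C i).rowSpX : Set (Q i → ZMod 2)) (DX i) p q) p₀) :
    IsThresholdBoxLowerBound (fun i p q => (C i).bothSectorsPhenomFailureProb (T i) (DZ i) (DX i) p q) p₀ := by
  intro p q hp hq hp' hq'
  exact (bothSectors_belowThreshold_iff C T DZ DX hp (by linarith) hq (by linarith)).2
    ⟨hZ p q hp hq hp' hq', hX p q hp hq hp' hq'⟩

end CSSCode

end Literature.InformationTheory.QuantumCodes

end
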